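import Summits.FinalStateConjecture.FinalStateConjecture.Theorems.BartnikGapSettlingSettledCaptureStubChartNullGeodesic
import Summits.FinalStateConjecture.FinalStateConjecture.Theorems.BartnikGapSettlingSettledCaptureStubBoostedCertificateStable
import Literature.Geometry.Lorentzian.CoordScalarCurvatureEvolution
import Literature.Geometry.Lorentzian.KerrSchildChartCovariance
import HarnessLib

/-!
# Crux `SettledCapture` (stmt-FinalStateConjecture-17328), line `null-concave-crush`:
# stub 3 `stub_crushTransport` — the crush certificate survives in `C¹`-close interior charts

Route `BartnikGapSettling`; helper (`--supports stmt-FinalStateConjecture-17328`) landing the stub `stub_crushTransport`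
of the checked skeleton `Cruxes/SettledCapture/Lines/null_concave_crush.lean` (registered in revs 1–4; from rev 5 on
DERIVED in the skeleton by the glue `crushTransport_of`), now as a tree theorem assembled from the two LANDED halves:

* 3a `stub_chartNullGeodesic` (p164700): a normalised null ray whose tail lies in an `η`-good interior chart,
  `η ≤ η₁`, pulls back to a `C²` coordinate curve `β` with velocity `β₁`, solving `β₁' = −Γ_G(β₁, β₁)` for the chart
  components `G = g_{M,a,Λ,c} + (Φ^*g − g_{M,a,Λ,c})`, `G`-null, `G`-future, with `η`-small jets of the deviation;
* 3b `stub_boostedCertificateStable` (p164592, worker C): the exact-Kerr certificate with margin survives, margin-free,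
  for every field of components whose 1-jet is `η_b`-close to boosted Kerr, on null / future vectors;

glued by the second-order chain rule: for `h = F ∘ r̃ ∘ β` one has `h' = d(F∘r̃)(β₁)` and
`h'' = D²(F∘r̃)(β₁, β₁) + d(F∘r̃)(β₁') = hessAt G (F∘r̃) β β₁ β₁` (`MetricCoord.hessAt_apply`), so 3b at the jet of `G`
along `β` gives `h' < 0` and `h h'' ≤ ρ h'²`; `h > 0` and `C²` on compact sub-tails are immediate. With the landed
stub 2 `stub_kerrCrushCertificate` (p162630) this is the complete, typing-independent MECHANISM of the line.
References: O'Neill 1983, Ch. 3, Lemma 3.49, Cor. 21.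
-/

noncomputable section

-- instance search through the nested operator types `E4 →L[ℝ] E4 →L[ℝ] E4 →L[ℝ] ℝ`
set_option maxSynthPendingDepth 3

-- D-0017: single-problem summit, `Summit.<S>.<S>.…` by design (cf. lakefile `weak.linter.dupNamespace`).
set_option linter.dupNamespace false

namespace Summit.FinalStateConjecture.FinalStateConjecture.Theorems.BartnikGapSettling.SettledCapture

open Set Filter Function TopologicalSpace
open scoped Manifold ContDiff Topology ENNReal
open Literature.Geometry.Lorentzian Literature.Geometry.Lorentzian.MetricCoord

/-- **Stub 3 of line `null-concave-crush` (crux `SettledCapture`, stmt-FinalStateConjecture-17328): CRUSH TRANSPORT —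
the weighted null-concave crush certificate of exact Kerr `(M, a)` at depth `δ` survives, margin-free, in every
development and every interior chart that is `η`-good on the late shell, `η = min(η_b, η₁)`:** along every normalised
null ray whose parameter tail lies in the chart image of `{t* > T, r₋ + δ < r < r₊ − δ}`, `h = F(r̃)` is positive,
`C²` on compact sub-tails, strictly decreasing and weighted-concave `h h'' ≤ ρ h'²`. Assembled from the landed halves
3a (`stub_chartNullGeodesic`) and 3b (`stub_boostedCertificateStable`) by the second-order chain rule. [folklore] -/
theorem stub_crushTransport : ∀ (M a δ ρ m : ℝ) (F : ℝ → ℝ) (mo : lorentzGroup × E4), 0 < M → |a| < M → 0 < δ → 0 < m → KerrCrushCertificate M a (Kerr.rMinus M a + δ) (Kerr.rPlus M a - δ) ρ m F → ∃ η : ℝ≥0∞, 0 < η ∧ ∀ (X : Type) [TopologicalSpace X] [ChartedSpace E3 X] [IsManifold (𝓡 3) ((⊤ : ℕ∞) : WithTop ℕ∞) X] [T2Space X] [SecondCountableTopology X] [ConnectedSpace X] (D : InitialDataSet (𝓡 3) X) (𝒟 : VacuumCauchyDevelopment D) (Φ : (interiorBackground mo M a (Kerr.rMinus M a)).domain → 𝒟.carrier)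 (T : ℝ), IsGoodInteriorChart 𝒟 mo M a Φ T (Kerr.rMinus M a + δ / 2) (Kerr.rPlus M a) η → ∀ [𝒟.metric.HasLeviCivita], ∀ (p : X) (γ : ℝ → 𝒟.carrier) (dom : Set ℝ), 𝒟.metric.IsNormalisedNullRayFrom 𝒟.timeOrientation 𝒟.embed 𝒟.normal p γ dom → ∀ t₀ ∈ dom, (∀ t ∈ dom, t₀ ≤ t → γ t ∈ Φ '' lateShell (interiorBackground mo M a (Kerr.rMinus M a)) T (Kerr.rMinus M a + δ) (Kerr.rPlus M a - δ)) → ∃ h : ℝ → ℝ, (∀ t ∈ dom, t₀ ≤ t → ∃ x ∈ lateShell (interiorBackground mo M a (Kerr.rMinus M a)) T (Kerr.rMinus M a + δ) (Kerr.rPlus M a - δ), Φ x = γ t ∧ h t = F ((interiorBackground mo M a (Kerr.rMinus M a)).radius x.1)) ∧ (∀ t ∈ dom, t₀ < t → 0 < h t) ∧ (∀ t' ∈ dom, t₀ < t' → ContDiffOn ℝ 2 h (Set.Icc t₀ t')) ∧ ∀ t ∈ dom, t₀ < t → deriv h t < 0 ∧ h t * deriv (deriv h) t ≤ ρ * deriv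 h t ^ 2 := by
  intro M a δ ρ m F mo hM ha hδ hm hcert
  obtain ⟨ηb, hηb, hstab⟩ := stub_boostedCertificateStable M a δ ρ m F mo hM ha hδ hm hcert
  obtain ⟨η₁, hη₁, hgeo⟩ := stub_chartNullGeodesic M a δ mo hM ha hδ
  refine ⟨min (ENNReal.ofReal ηb) η₁, lt_min (ENNReal.ofReal_pos.2 hηb) hη₁, ?_⟩
  intro X _ _ _ _ _ _ D 𝒟 Φ T hgood inst p γ dom hγ t₀ ht₀ htail
  obtain ⟨β, β₁, hβ⟩ :=
    hgeo X D 𝒟 Φ T (min (ENNReal.ofReal ηb) η₁) (min_le_right _ _) hgood p γ dom hγ t₀ ht₀ htail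
  have hηle : (min (ENNReal.ofReal ηb) η₁).toReal ≤ ηb :=
    ENNReal.toReal_le_of_le_ofReal hηb.le (min_le_left _ _)
  -- the profile in the boosted frame
  set f : E4 → ℝ := F ∘ Kerr.radius a ∘ poincareInv mo.1 mo.2 with hfdef
  have hdom : dom.OrdConnected := hγ.1.2.1
  have hopen : IsOpen dom := hγ.1.1
  -- `f` is `C²` at every point of positive rest-frame radius
  have hfC2 : ∀ y : E4, 0 < Kerr.radius a (poincareInv mo.1 mo.2 y) → ContDiffAt ℝ 2 f y := by
    intro y hy
    have hP : ContDiffAt ℝ 2 (poincareInv mo.1 mo.2) y :=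
      (KerrSchildChart.contDiff_poincareInv (Λ := mo.1) (c := mo.2)).contDiffAt
    have hr : ContDiffAt ℝ 2 (Kerr.radius a) (poincareInv mo.1 mo.2 y) :=
      ((Kerr.contDiffOn_radius_region a 0).contDiffAt
        ((Kerr.region a 0).isOpen.mem_nhds
          (show poincareInv mo.1 mo.2 y ∈ Kerr.region a 0 by
            rw [Kerr.mem_region, max_self]; exact hy))).of_le (WithTop.coe_le_coe.2 le_top)
    exact hcert.1.contDiffAt.comp y (hr.comp y hP)
  have hr₁pos : 0 < Kerr.rMinus M a + δ := by
    have := Kerr.IsSubextremal.rMinus_nonneg ha; linarith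
  -- radius window along the tail
  have hwin : ∀ t ∈ dom, t₀ ≤ t → Kerr.rMinus M a + δ < Kerr.radius a (poincareInv mo.1 mo.2 (β t)) ∧
      Kerr.radius a (poincareInv mo.1 mo.2 (β t)) < Kerr.rPlus M a - δ := by
    intro t ht htt
    obtain ⟨⟨x, hx, -, hβx⟩, -⟩ := hβ t ht htt
    rw [hβx]
    exact ⟨hx.2.1, hx.2.2⟩
  refine ⟨fun t ↦ f (β t), ?_, ?_, ?_, ?_⟩
  · -- (i) the representation `h t = F (r̃ x)` with `Φ x = γ t`
    intro t ht htt
    obtain ⟨⟨x, hx, hΦx, hβx⟩, -⟩ := hβ t ht htt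
    refine ⟨x, hx, hΦx, ?_⟩
    simp only [hfdef, Function.comp_apply, hβx]
    rfl
  · -- (ii) positivity
    intro t ht htt
    obtain ⟨h1, h2⟩ := hwin t ht htt.le
    exact hcert.2.1 _ ⟨h1.le, h2.le⟩
  · -- (iii) `C²` on compact sub-tails
    intro t' ht' htt' t ht
    have htdom : t ∈ dom := hdom.out ht₀ ht' ⟨ht.1, ht.2⟩
    obtain ⟨-, hβC2, -⟩ := hβ t htdom ht.1
    have hpos : 0 < Kerr.radius a (poincareInv mo.1 mo.2 (β t)) := hr₁pos.trans (hwin t htdom ht.1).1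
    exact ((hfC2 (β t) hpos).comp t hβC2).contDiffWithinAt
  · -- (iv) the derivatives on the open tail `dom ∩ (t₀, ∞)`
    intro t ht htt
    obtain ⟨⟨x, hx, hΦx, hβx⟩, hβC2, hβ', hβ₁', hnull, hfut, hdev0, hdev1⟩ := hβ t ht htt.le
    have hpos : 0 < Kerr.radius a (poincareInv mo.1 mo.2 (β t)) := hr₁pos.trans (hwin t ht htt.le).1
    have hfd : HasFDerivAt f (fderiv ℝ f (β t)) (β t) :=
      ((hfC2 (β t) hpos).differentiableAt (by norm_num)).hasFDerivAt
    -- first derivative: `h' s = Df(β s)(β₁ s)` near `t`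
    have hder : ∀ s ∈ dom, t₀ < s → HasDerivAt (fun s ↦ f (β s)) (fderiv ℝ f (β s) (β₁ s)) s := by
      intro s hs hss
      obtain ⟨-, -, hβ's, -⟩ := hβ s hs hss.le
      have hposs : 0 < Kerr.radius a (poincareInv mo.1 mo.2 (β s)) := hr₁pos.trans (hwin s hs hss.le).1
      exact (((hfC2 (β s) hposs).differentiableAt (by norm_num)).hasFDerivAt).comp_hasDerivAt s hβ's
    have hnhds : ∀ᶠ s in 𝓝 t, s ∈ dom ∧ t₀ < s :=
      Filter.eventually_of_mem ((hopen.inter isOpen_Ioi).mem_nhds ⟨ht, htt⟩) fun s hs ↦ hs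
    have hderiv_eq : deriv (fun s ↦ f (β s)) =ᶠ[𝓝 t] fun s ↦ fderiv ℝ f (β s) (β₁ s) := by
      filter_upwards [hnhds] with s hs
      exact (hder s hs.1 hs.2).deriv
    have hd1 : deriv (fun s ↦ f (β s)) t = fderiv ℝ f (β t) (β₁ t) := (hder t ht htt).deriv
    -- second derivative: `h'' t = D²f(β₁, β₁) + Df(β₁') = hessAt G f (β t) (β₁ t) (β₁ t)`
    have hfC1 : ContDiffAt ℝ 1 (fderiv ℝ f) (β t) :=
      (hfC2 (β t) hpos).fderiv_right (m := 1) (by norm_num)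
    have hc : HasDerivAt (fun s ↦ fderiv ℝ f (β s)) (fderiv ℝ (fderiv ℝ f) (β t) (β₁ t)) t :=
      (hfC1.differentiableAt (by norm_num)).hasFDerivAt.comp_hasDerivAt t hβ'
    have h2 := hc.clm_apply hβ₁'
    have hd2 : deriv (deriv fun s ↦ f (β s)) t =
        hessAt (fun y ↦ boostedKerrBilin mo.1 mo.2 M a y +
          𝒟.toSpacetime.deviationExtend (interiorBackground mo M a (Kerr.rMinus M a)) Φ y) f (β t) (β₁ t) (β₁ t) := by
      rw [hderiv_eq.deriv_eq, h2.deriv, hessAt_apply, map_neg, sub_eq_add_neg]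
    -- the perturbed certificate at the jet of `G` along `β`
    have hG0 : ‖(fun y ↦ boostedKerrBilin mo.1 mo.2 M a y +
          𝒟.toSpacetime.deviationExtend (interiorBackground mo M a (Kerr.rMinus M a)) Φ y) (β t) -
        boostedKerrBilin mo.1 mo.2 M a (β t)‖ ≤ ηb := by
      simp only [add_sub_cancel_left]
      exact hdev0.trans hηle
    have hG1 := hdev1.trans hηle
    obtain ⟨hslope, hconc⟩ := hstab (fun y ↦ boostedKerrBilin mo.1 mo.2 M a y +
      𝒟.toSpacetime.deviationExtend (interiorBackground mo M a (Kerr.rMinus M a)) Φ y) (β t)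
      (hwin t ht htt.le).1.le (hwin t ht htt.le).2.le hG0 hG1 (β₁ t) hnull
    refine ⟨?_, ?_⟩
    · rw [hd1]
      exact hslope hfut
    · rw [hd2, hd1]
      exact hconc

end Summit.FinalStateConjecture.FinalStateConjecture.Theorems.BartnikGapSettling.SettledCapture

end
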